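import Summits.CriticalPhenomena.SAWScalingLimit.Theorems.LeftRightFKG.Negative.LatticeSegments
import Literature.Probability.LatticeModels.LatticeInterface
import Literature.Probability.RandomPlanarGeometry.PolygonShadowWinding
import HarnessLib

/-!
# Negative knowledge on crux `LeftRightFKG`, part 2: winding numbers of closed lattice polylines

**`wind_poly_probeL`**: the winding number of a closed lattice polyline (iterated `Path.trans` of unit
segments = the parametrisation of `SimpleGraph.Walk.toCurve`, hence exactly the loops of the crux after
`Set.IccExtend`) about the centre of the face `(m, k)` is minus its signed count of crossings of the
upward probe; **`wcross_le_of_wind_nonneg`**: consequently the crux's relation `le γ₁ γ₂` (the lens loop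
`γ₁·γ₂⁻¹` winds non-negatively about every point) forces `wcross m k γ₁ ≤ wcross m k γ₂` for every face —
the left–right order is dominance of crossing counts.

Overlap (not importable as is): the same analytic/combinatorial bridge for the periodic `ClosedWalk n`
loops of the Kasteleyn files is `ClosedWalk.wind_loop_sub_ctr` (`LatticeLoopEnclosure.lean`, horizontal
probe, vertices in `ℤ × ℤ`, its own `Path` construction `ClosedWalk.loop`); the crux's loops are the
`Set.IccExtend` of `SimpleGraph.Walk.toCurve` of walks of `zdGraph 2` on `Site 2 = Fin 2 → ℤ` with the
`polylineFrom` parametrisation, and no conversion between the two loop constructions exists in the tree,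
so the bridge is re-established here directly for `polylineFrom` (sharing `Path.crossInc`). [folklore]
-/

noncomputable section

open Real Set Complex Literature.Probability.LatticeModels Literature.Probability.RandomPlanarGeometry
  Literature.Topology.PlaneTopology

namespace Summit.CriticalPhenomena.SAWScalingLimit.Theorems.LeftRightFKG.Negative

/-! ## Lattice polylines: range, crossing defect, winding number at a face centre -/

/-- Signed crossing count of the vertex chain `a, l₀, l₁, …` over the probe. [folklore] -/
def pathCross (m k : ℤ) : Site 2 → List (Site 2) → ℤ
  | _, [] => 0
  | a, b :: l => edgeCross m k a b + pathCross m k b l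

/-- `pathCross_nil` (auxiliary). [folklore] -/
@[simp] theorem pathCross_nil (m k : ℤ) (a : Site 2) : pathCross m k a [] = 0 := rfl
/-- `pathCross_cons` (auxiliary). [folklore] -/
@[simp] theorem pathCross_cons (m k : ℤ) (a b : Site 2) (l : List (Site 2)) :
    pathCross m k a (b :: l) = edgeCross m k a b + pathCross m k b l := rfl

/-- The polyline through `pt a, pt l₀, pt l₁, …` as a `Path` (iterated `Path.trans` of unit
segments, the parametrisation of `SimpleGraph.Walk.toCurve`). [folklore] -/
abbrev poly (a : Site 2) (l : List (Site 2)) : Path (pt a) (polylineFrom (pt a) (l.map pt)).1 :=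
  (polylineFrom (pt a) (l.map pt)).2

/-- `range_poly_cons` (auxiliary). [folklore] -/
theorem range_poly_cons (a b : Site 2) (l : List (Site 2)) :
    range (poly a (b :: l)) = segment ℝ (pt a) (pt b) ∪ range (poly b l) := by
  show range ((Path.segment (pt a) (pt b)).trans (poly b l)) = _
  rw [Path.trans_range, Path.range_segment]

/-- Every point of a lattice polyline has an integral coordinate. [folklore] -/
theorem exists_int_of_mem_range_poly :
    ∀ (a : Site 2) (l : List (Site 2)), List.IsChain (zdGraph 2).Adj (a :: l) →
      ∀ z ∈ range (poly a l), (∃ n : ℤ, z.re = n) ∨ (∃ n : ℤ, z.im = n)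
  | a, [], _, z, hz => by
    have : z = pt a := by
      obtain ⟨t, rfl⟩ := hz
      rfl
    exact Or.inl ⟨a 0, by rw [this, pt_re]⟩
  | a, b :: l, hc, z, hz => by
    rw [range_poly_cons] at hz
    rw [List.isChain_cons_cons] at hc
    rcases hz with hz | hz
    · exact exists_int_of_mem_segment hc.1 hz
    · exact exists_int_of_mem_range_poly b l hc.2 z hz

/-- `probeL_not_mem_range_poly` (auxiliary). [folklore] -/
theorem probeL_not_mem_range_poly (m k : ℤ) {a : Site 2} {l : List (Site 2)}
    (hc : List.IsChain (zdGraph 2).Adj (a :: l)) : probeL m k ∉ range (poly a l) := by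
  intro h
  rcases exists_int_of_mem_range_poly a l hc _ h with ⟨n, hn⟩ | ⟨n, hn⟩
  · exact int_add_half_ne_int m n (by rw [← hn, probeL_re])
  · exact int_add_half_ne_int k n (by rw [← hn, probeL_im])

/-- `probeR_not_mem_range_poly` (auxiliary). [folklore] -/
theorem probeR_not_mem_range_poly (m Y : ℤ) {a : Site 2} {l : List (Site 2)}
    (hc : List.IsChain (zdGraph 2).Adj (a :: l)) : probeR m Y ∉ range (poly a l) := by
  intro h
  rcases exists_int_of_mem_range_poly a l hc _ h with ⟨n, hn⟩ | ⟨n, hn⟩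
  · exact int_add_half_ne_int m n (by rw [← hn, probeR_re])
  · exact threeQuarter_ne_int Y n (by rw [← hn, probeR_im])

/-- A lattice polyline stays in any convex set containing its vertices. [folklore] -/
theorem range_poly_subset {S : Set ℂ} (hS : Convex ℝ S) :
    ∀ (a : Site 2) (l : List (Site 2)), pt a ∈ S → (∀ x ∈ l, pt x ∈ S) → range (poly a l) ⊆ S
  | a, [], ha, _ => by
    rintro z ⟨t, rfl⟩
    exact ha
  | a, b :: l, ha, hl => by
    rw [range_poly_cons]
    refine union_subset (hS.segment_subset ha (hl b (by simp))) ?_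
    exact range_poly_subset hS b l (hl b (by simp)) fun x hx => hl x (by simp [hx])

/-- **Crossing defect of a lattice polyline** = `-2πi ·` its signed crossing count. [folklore] -/
theorem crossInc_poly {m k Y : ℤ} (hkY : k ≤ Y) :
    ∀ (a : Site 2) (l : List (Site 2)), List.IsChain (zdGraph 2).Adj (a :: l) → a 1 ≤ Y →
      (∀ x ∈ l, x 1 ≤ Y) →
      (poly a l).crossInc (probeL m k) (probeR m Y) = -(2 * π * I) * pathCross m k a l
  | a, [], _, _, _ => by
    show (Path.refl (pt a)).crossInc _ _ = _
    rw [Path.crossInc_refl]; simp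
  | a, b :: l, hc, ha, hl => by
    rw [List.isChain_cons_cons] at hc
    have hb : b 1 ≤ Y := hl b (by simp)
    have hl' : ∀ x ∈ l, x 1 ≤ Y := fun x hx => hl x (by simp [hx])
    show ((Path.segment (pt a) (pt b)).trans (poly b l)).crossInc _ _ = _
    rw [Path.crossInc_trans]
    · rw [crossInc_edge hkY hc.1 ha, crossInc_poly hkY b l hc.2 hb hl', pathCross_cons]
      push_cast; ring
    · rw [Path.range_segment]; exact probeL_not_mem_segment m k hc.1
    · exact probeL_not_mem_range_poly m k hc.2
    · rw [Path.range_segment]; exact probeR_not_mem_segment m Y hc.1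
    · exact probeR_not_mem_range_poly m Y hc.2

/-- Far above the polyline the winding number vanishes. [folklore] -/
theorem wind_poly_probeR {m Y : ℤ} (a : Site 2) (l : List (Site 2)) (ha : a 1 ≤ Y)
    (hl : ∀ x ∈ l, x 1 ≤ Y) (hend : (polylineFrom (pt a) (l.map pt)).1 = pt a) :
    wind (fun t => (poly a l).extend t - probeR m Y) = 0 := by
  set P := poly a l with hP
  set K : Set ℂ := {z | z.im ≤ Y} with hK
  have hKc : IsClosed K := isClosed_le Complex.continuous_im continuous_const
  have hKconv : Convex ℝ K := convex_halfSpace_im_le _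
  have hrange : range P ⊆ K :=
    range_poly_subset hKconv a l (by simp [hK]; exact_mod_cast ha)
      fun x hx => by simp [hK]; exact_mod_cast hl x hx
  obtain ⟨M, hM⟩ := (isCompact_range P.continuous).isBounded.exists_norm_le
  have hmaps : MapsTo P.extend (Icc 0 1) K := fun t ht => by
    rw [Path.extend_apply P ht]; exact hrange ⟨_, rfl⟩
  have hM' : ∀ t ∈ Icc (0 : ℝ) 1, ‖P.extend t‖ ≤ M := fun t ht => by
    rw [Path.extend_apply P ht]; exact hM _ ⟨_, rfl⟩
  have h01 : P.extend 0 = P.extend 1 := by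
    rw [Path.extend_zero, Path.extend_one, hend]
  have hz : probeR m Y ∉ K := by
    simp only [hK, mem_setOf_eq, probeR_im, not_le]; linarith
  set w : ℂ := ⟨m + 1 / 2, max ((Y : ℝ) + 3 / 4) 0 + |M| + 1⟩ with hw
  have hwM : M < ‖w‖ := by
    have h1 : |w.im| ≤ ‖w‖ := Complex.abs_im_le_norm w
    have h2 : w.im = max ((Y : ℝ) + 3 / 4) 0 + |M| + 1 := rfl
    have h3 : (0 : ℝ) ≤ max ((Y : ℝ) + 3 / 4) 0 := le_max_right _ _
    have h4 : M ≤ |M| := le_abs_self M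
    rw [abs_of_nonneg (by rw [h2]; positivity)] at h1
    linarith
  have hseg : segment ℝ (probeR m Y) w ⊆ Kᶜ := by
    intro z hz'
    obtain ⟨hlo, -⟩ := im_mem_of_mem_segment hz'
    simp only [hK, mem_compl_iff, mem_setOf_eq, not_le]
    have h2 : w.im = max ((Y : ℝ) + 3 / 4) 0 + |M| + 1 := rfl
    have h3 : (Y : ℝ) + 3 / 4 ≤ max ((Y : ℝ) + 3 / 4) 0 := le_max_left _ _
    have h5 : (0:ℝ) ≤ |M| := abs_nonneg M
    have hmin : (Y : ℝ) + 3 / 4 ≤ min (probeR m Y).im w.im := by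
      rw [probeR_im, h2]; apply le_min le_rfl; linarith
    linarith
  have hwc : w ∈ connectedComponentIn Kᶜ (probeR m Y) :=
    (convex_segment _ _).isPreconnected.subset_connectedComponentIn (left_mem_segment _ _ _) hseg
      (right_mem_segment _ _ _)
  exact wind_sub_eq_zero_of_joined P.continuous_extend.continuousOn h01 hKc hmaps hM' hz hwc hwM

/-- **Winding number of a closed lattice polyline about a face centre** = minus its signed
crossing count over the upward probe. [folklore] -/
theorem wind_poly_probeL {m k Y : ℤ} (hkY : k ≤ Y) (a : Site 2) (l : List (Site 2))
    (hc : List.IsChain (zdGraph 2).Adj (a :: l)) (ha : a 1 ≤ Y) (hl : ∀ x ∈ l, x 1 ≤ Y)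
    (hend : (polylineFrom (pt a) (l.map pt)).1 = pt a) :
    (wind (fun t => (poly a l).extend t - probeL m k) : ℂ) = -pathCross m k a l := by
  set P := poly a l with hP
  let P' : Path (pt a) (pt a) := P.cast rfl hend.symm
  have hcoe : range P' = range P := rfl
  have hℓ : probeL m k ∉ range P' := hcoe ▸ probeL_not_mem_range_poly m k hc
  have hr : probeR m Y ∉ range P' := hcoe ▸ probeR_not_mem_range_poly m Y hc
  have key := Path.crossInc_loop P' hℓ hr
  have hext : P'.extend = P.extend := rfl
  rw [hext, wind_poly_probeR a l ha hl hend, Int.cast_zero, sub_zero] at key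
  have hcr : P'.crossInc (probeL m k) (probeR m Y) = P.crossInc (probeL m k) (probeR m Y) := by
    have he : crossRatioFn (probeL m k) (probeR m Y) (polylineFrom (pt a) (l.map pt)).1 =
        crossRatioFn (probeL m k) (probeR m Y) (pt a) := by rw [hend]
    simp only [Path.crossInc, Path.argInc, hext, he]
  rw [hcr, crossInc_poly hkY a l hc ha hl] at key
  have h2 : (2 * π * I : ℂ) ≠ 0 := by simp [Real.pi_ne_zero, I_ne_zero]
  have key' : (wind (fun t => P.extend t - probeL m k) : ℂ) * (2 * π * I) =
      (-(pathCross m k a l : ℂ)) * (2 * π * I) := by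
    rw [← key]; ring
  exact mul_right_cancel₀ h2 key'

/-! ## Walks on lattice graphs: their polylines and crossing counts -/

section Walks

variable {G : SimpleGraph (Site 2)} {u v : Site 2}

/-- `meshPoint_one_eq` (auxiliary). [folklore] -/
theorem meshPoint_one_eq : meshPoint (1 : ℝ) = pt := funext meshPoint_one

/-- The curve of a walk (embedding `pt`) is the polyline of its support. [folklore] -/
theorem toCurve_pt (w : G.Walk u v) : w.toCurve pt = (poly u w.support.tail).toContinuousMap := by
  cases w <;> rfl

/-- The loop function appearing in the crux, as a `Path.extend`. [folklore] -/
theorem iccExtend_toCurve (w : G.Walk u v) :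
    (fun t : ℝ => Set.IccExtend zero_le_one (w.toCurve (meshPoint 1)) t) =
      (poly u w.support.tail).extend := by
  rw [meshPoint_one_eq, toCurve_pt]; rfl

/-- `iccExtend_toCurve_apply` (auxiliary). [folklore] -/
theorem iccExtend_toCurve_apply (w : G.Walk u v) (t : ℝ) :
    Set.IccExtend zero_le_one (w.toCurve (meshPoint 1)) t = (poly u w.support.tail).extend t :=
  congrFun (iccExtend_toCurve w) t

/-- The polyline of a walk ends at its endpoint. [folklore] -/
theorem poly_fst_walk : ∀ {u v : Site 2} (w : G.Walk u v),
    (polylineFrom (pt u) (w.support.tail.map pt)).1 = pt v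
  | _, _, SimpleGraph.Walk.nil => rfl
  | _, _, SimpleGraph.Walk.cons (v := v') _ p => by
    show (polylineFrom _ (p.support.map pt)).1 = _
    rw [← p.cons_tail_support]
    exact poly_fst_walk p

/-- The support of a walk is a lattice chain when the graph is a lattice subgraph. [folklore] -/
theorem isChain_support (hG : ∀ x y, G.Adj x y → (zdGraph 2).Adj x y) (w : G.Walk u v) :
    List.IsChain (zdGraph 2).Adj (u :: w.support.tail) := by
  rw [w.cons_tail_support]
  exact w.isChain_adj_support.imp fun _ _ h => hG _ _ h

/-- The signed crossing count of a walk over the probe of the face `(m, k)`. [folklore] -/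
def wcross (m k : ℤ) (w : G.Walk u v) : ℤ := pathCross m k u w.support.tail

/-- `wcross_eq_darts` (auxiliary). [folklore] -/
theorem wcross_eq_darts (m k : ℤ) : ∀ {u v : Site 2} (w : G.Walk u v),
    wcross m k w = (w.darts.map fun d => edgeCross m k d.fst d.snd).sum
  | _, _, SimpleGraph.Walk.nil => rfl
  | _, _, SimpleGraph.Walk.cons (v := v') h p => by
    unfold wcross
    show pathCross m k _ p.support = _
    rw [← p.cons_tail_support, pathCross_cons, SimpleGraph.Walk.darts_cons, List.map_cons, List.sum_cons]
    congr 1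
    exact wcross_eq_darts m k p

/-- `wcross_append` (auxiliary). [folklore] -/
theorem wcross_append (m k : ℤ) {u v w : Site 2} (p : G.Walk u v) (q : G.Walk v w) :
    wcross m k (p.append q) = wcross m k p + wcross m k q := by
  simp only [wcross_eq_darts, SimpleGraph.Walk.darts_append, List.map_append, List.sum_append]

/-- `wcross_reverse` (auxiliary). [folklore] -/
theorem wcross_reverse (m k : ℤ) {u v : Site 2} (p : G.Walk u v) :
    wcross m k p.reverse = -wcross m k p := by
  simp only [wcross_eq_darts, SimpleGraph.Walk.darts_reverse, List.map_reverse, List.sum_reverse,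
    List.map_map]
  have : (fun d : G.Dart => edgeCross m k d.fst d.snd) ∘ SimpleGraph.Dart.symm =
      fun d => -edgeCross m k d.fst d.snd := by
    funext d
    simp only [Function.comp_apply, SimpleGraph.Dart.symm_toProd, Prod.fst_swap, Prod.snd_swap]
    exact edgeCross_symm m k d.fst d.snd
  rw [this]
  generalize p.darts = L
  induction L with
  | nil => simp
  | cons d t ih => simp only [List.map_cons, List.sum_cons, ih]; ring

/-- **Monotonicity of the crossing count along the left–right relation**: if the lens loop
`w₁ · w₂⁻¹` has non-negative winding number about the centre of the face `(m, k)`, then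
`wcross m k w₁ ≤ wcross m k w₂` (vertices of height `≤ Y`, `k ≤ Y`). [folklore] -/
theorem wcross_le_of_wind_nonneg (hG : ∀ x y, G.Adj x y → (zdGraph 2).Adj x y) {a b : Site 2}
    (w₁ w₂ : G.Walk a b) {m k Y : ℤ} (hkY : k ≤ Y) (h₁ : ∀ x ∈ w₁.support, x 1 ≤ Y)
    (h₂ : ∀ x ∈ w₂.support, x 1 ≤ Y)
    (hw : 0 ≤ wind (fun t : ℝ =>
      Set.IccExtend zero_le_one ((w₁.append w₂.reverse).toCurve (meshPoint 1)) t - probeL m k)) :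
    wcross m k w₁ ≤ wcross m k w₂ := by
  set w := w₁.append w₂.reverse with hwdef
  simp only [iccExtend_toCurve_apply] at hw
  have hsupp : ∀ x ∈ w.support, x 1 ≤ Y := by
    intro x hx
    rw [hwdef, SimpleGraph.Walk.mem_support_append_iff, SimpleGraph.Walk.support_reverse,
      List.mem_reverse] at hx
    rcases hx with hx | hx
    exacts [h₁ x hx, h₂ x hx]
  have key := wind_poly_probeL (m := m) hkY a w.support.tail (isChain_support hG w)
    (h₁ a w₁.start_mem_support) (fun x hx => hsupp x (List.mem_of_mem_tail hx)) (poly_fst_walk w)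
  have key' : wind (fun t => (poly a w.support.tail).extend t - probeL m k) = -wcross m k w := by
    unfold wcross; exact_mod_cast key
  rw [key', hwdef, wcross_append, wcross_reverse] at hw
  omega

end Walks

end Summit.CriticalPhenomena.SAWScalingLimit.Theorems.LeftRightFKG.Negative
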